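import Summits.QuantumFields.YangMills.Theorems.FluctuationComparisonRegPrIntLHeightwisePersistenceOfBounds5
import Summits.QuantumFields.YangMills.Theorems.FluctuationComparisonRegPrIntLHaarTubeNoMargin
import HarnessLib

/-!
# `FluctuationComparisonRegPrIntLTubeFromBounds5Literal` — TUBE∘ `SectionTubeMassIntCan` ⟸ [Balaban1985UV3] THEOREM 1 (5), BOTH HALVES, ON PRINT'S γ-SCALED WINDOW AT THE
# DOUBLED PROFILE `2b₀` — AND NOTHING ELSE (crux `FluctuationComparisonRegPrIntL`, stmt-QuantumFields-20520; LINE g22-4 ∕ g22-6 row TUBE∘; the TUBE∘ twin of w5-20520 g17's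
# ✓`…HeightwisePersistencePrintLiteral.oneLevelPersistenceIntCan_of_bounds5Literal_thm1`)

Cell `ym3-torus` (YM ladder rung R3 = continuum SU(2) Yang–Mills on T³ — a RUNG, NOT d = 4, NOT infinite volume, NOT a mass gap, NOT Clay);
width seat `ym-ust-20520-w4` (gen 18), explicit-unit helper; `--supports stmt-QuantumFields-20520 --as helper`.  THEOREMS ONLY (0 `def`, 0 `sorry`,
default heartbeats).

WHAT.  w5-20520 g17's ✓p766920 §4 `sectionTubeMassIntCan_of_bounds5TwoSided_balabanWindow_haarTube` reads TUBE∘ from print's (5) both halves at profile `2b₀` PLUS the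
K-free letter ⟨HAAR-TUBE₁⟩ — which is a THEOREM of the tree since ✓p765736 (w4, `haarTube_noMargin_depthOne`, folded into ✓`sectionTubeMassIntCan_of_up_low`).  THIS FILE is
that §4 with the idle letter DROPPED (LEAD w3-20520 g19 08:47:49Z «drop the idle ⟨HAAR-TUBE₁⟩ letter»): ★★★★ `sectionTubeMassIntCan_of_bounds5TwoSided_balabanWindow` — hypothesis
(TUBE∘'s prefix with `γ₁ ≤ 1`; after `F, γ`): `∃ E, Bounds5UpperAtHeight F γ E ∧ ∀ n, ∃ c_n > 0, ∀ K ≥ n, ∀ᵐ V, PlaqSmall (θBal F.L γ (2·b₀) p₀ n) V → c_n ≤ e^{−E_K}·heightDensity`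
(print's (5): the upper schema lit `Bounds5UpperAtHeight`, the lower half a.e. on print's window (7) at the profile `2b₀` — TUBE∘'s ⟨LOW(2θ)⟩ set IS that window, lit ✓`θBal_mul`);
conclusion: TUBE∘ VERBATIM.  Proof = w5's §4 body (quotient algebra ✓`heightwiseUpperBound_of_bounds5TwoSided` ∕ ✓`quotient_lower_ae` ∕ ✓`integral_heightDensity_univ_eq_partitionFn`
from ✓`…HeightwiseQuotientOfBounds5`∕✓`…HeightwisePersistenceOfBounds5`, LEAD g18's ✓`up_of_heightwiseUpperBound`∕✓`low_of_heightwiseLowerDensity`) fed into w4's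
✓`…HaarTubeNoMargin.sectionTubeMassIntCan_of_up_low` instead of ✓p764339's three-letter door.  Credit: the mathematics of the (5)-reading is w5-20520 g17's; the no-margin
tube letter is ✓p765736.

HONEST SCOPE.  A knit; Thm 1 (5) NOT proved ⇒ TUBE∘ remains CONDITIONAL on it (and on nothing else); FH∘, PERS₁∘, PLAQTAIL∘, LFR♯ᶜ∘, S2β, the crux 20520 and every rung
statement are NOT proved; `YM3TorusSU2` NOT proved; the Yang–Mills mass gap (Clay) NOT proved.

References: T. Bałaban, Commun. Math. Phys. **102** (1985) 255–275 [Balaban1985UV3] ((4)–(7) pp. 256–257, Thm 1 p. 257, (41) p. 266); CMP **98** (1985) 17–51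
[Balaban1985Averaging] ((10) p. 19, Prop. 1 p. 22); CMP **109** (1987) 249–301 [Balaban1987RG1] ((0.18)–(0.22) p. 255).
-/

noncomputable section

set_option autoImplicit false

open MeasureTheory Filter Topology Set
open scoped ENNReal
open Literature.MathematicalPhysics.QuantumFieldTheory.Balaban1983to89
open Literature.MathematicalPhysics.QuantumFieldTheory.Balaban1983to89.T3ContinuumYM3Torus
open Literature.MathematicalPhysics.QuantumFieldTheory.Balaban1983to89.T3UnitLawDensityEML
open Literature.MathematicalPhysics.QuantumFieldTheory.Balaban1983to89.T3UnitScaleTilt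
open Literature.MathematicalPhysics.QuantumFieldTheory.Balaban1983to89.T3TiltDescent
open Literature.MathematicalPhysics.QuantumFieldTheory.Balaban1983to89.T3HeightwiseDensityBounds
open Literature.MathematicalPhysics.QuantumFieldTheory.Balaban1983to89.Missing
open Summit.QuantumFields.YangMills.Theorems.FluctuationComparisonRegPrIntLHeightwiseQuotientOfBounds5
open Summit.QuantumFields.YangMills.Theorems.FluctuationComparisonRegPrIntLPersistenceFromHeightwiseBounds
open Summit.QuantumFields.YangMills.Theorems.FluctuationComparisonRegPrIntLHeightwisePersistenceOfBounds5

namespace Summit.QuantumFields.YangMills.Theorems.FluctuationComparisonRegPrIntLTubeFromBounds5Literal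

/-- ★★★★ **TUBE∘ `SectionTubeMassIntCan` VERBATIM ⟸ THEOREM 1 (5), BOTH HALVES, ON PRINT'S WINDOW AT PROFILE `2·b₀` — AND NOTHING ELSE.**  TUBE∘'s ⟨LOW(2θ)⟩ set
`{PlaqSmall 2θ_{J+1}(b₀)}` IS print's γ-scaled window at the profile `2b₀` (`θBal(2·b₀) = 2·θBal(b₀)`, lit ✓`T3InteriorExcision.θBal_mul`; print's `b₀` is «a sufficiently large
absolute constant», so the larger profile is print-admissible).  Hypothesis = TUBE∘'s prefix (`γ₁ ≤ 1`) with, after `F, γ`, `∃ E, Bounds5UpperAtHeight F γ E ∧ ∀ n, ∃ c_n > 0, ∀ K ≥ n,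
∀ᵐ V, PlaqSmall θBal_n(2b₀) V → c_n ≤ e^{−E_K}ρ_{K−n}(V)` ⟹ TUBE∘ byte for byte — no ⟨HAAR-TUBE₁⟩ (✓p765736), no γ-shrinking beyond `γ₁ ≤ 1`.  (w5-20520 g17's ✓p766920 §4 with
the idle letter dropped; the (5)-reading is theirs.)  HONEST SCOPE: a door; (5) NOT proved; TUBE∘∕PERS₁∘∕LFR♯ᶜ∘∕20520 NOT proved.
[cite: Balaban1985UV3, (4)-(7) pp.256-257, Thm 1 p.257; Balaban1985Averaging, Prop. 1 p.22; Balaban1987RG1, (0.18)-(0.22) p.255] -/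
theorem sectionTubeMassIntCan_of_bounds5TwoSided_balabanWindow
    (h : ∀ (L : ℕ), ∃ c₀ : ℝ, 0 < c₀ ∧ c₀ ≤ 1 ∧ ∀ (c : ℝ), 0 < c → c ≤ c₀ → ∃ pS : ℝ, ∀ (b₀ p₀ : ℝ), 0 < b₀ → pS ≤ p₀ → 0 < p₀ →
      ∃ γ₁ : ℝ, 0 < γ₁ ∧ γ₁ ≤ 1 ∧ ∀ (F : T3Family) (γ : ℝ), F.L = L → 0 < γ → γ ≤ γ₁ →
        (∃ E : ℕ → ℝ, Bounds5UpperAtHeight F γ E ∧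
          ∀ n : ℕ, ∃ cn : ℝ, 0 < cn ∧ ∀ (K : ℕ) (hK : n ≤ K),
            ∀ᵐ V ∂(fieldMeasure (F.P n) 0 (Matrix.specialUnitaryGroup (Fin 2) ℂ)), PlaqSmall (θBal F.L γ (2 * b₀) p₀ n) V →
              cn ≤ Real.exp (-E K) * heightDensity F γ hK Set.univ V)) :
    ∀ (L : ℕ), ∃ c₀ : ℝ, 0 < c₀ ∧ c₀ ≤ 1 ∧ ∀ (c : ℝ), 0 < c → c ≤ c₀ → ∃ pS : ℝ, ∀ (b₀ p₀ : ℝ), 0 < b₀ → pS ≤ p₀ → 0 < p₀ →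
      ∃ γ₁ : ℝ, 0 < γ₁ ∧ ∀ (F : T3Family) (γ : ℝ), F.L = L → 0 < γ → γ ≤ γ₁ →
        ∀ (J : ℕ) (r : ℝ), 0 < r →
          ∀ σ : GaugeField (F.P J) 0 (Matrix.specialUnitaryGroup (Fin 2) ℂ) → GaugeField (F.P (J + 1)) 0 (Matrix.specialUnitaryGroup (Fin 2) ℂ), Measurable σ →
            (∀ U : GaugeField (F.P J) 0 (Matrix.specialUnitaryGroup (Fin 2) ℂ), PlaqSmall (θBal F.L γ (c * b₀) p₀ J) U →
              descendTo F ℰp J (J + 1) (Nat.le_succ J) (σ U) = U ∧ PlaqSmall (θBal F.L γ b₀ p₀ (J + 1)) (σ U)) →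
            ∃ q : ℝ, 0 < q ∧ ∀ (K : ℕ) (hJK : J + 1 ≤ K)
              (B : Set (GaugeField (F.P J) 0 (Matrix.specialUnitaryGroup (Fin 2) ℂ))), MeasurableSet B →
                B ⊆ {U | PlaqSmall (θBal F.L γ (c * b₀) p₀ J) U} →
                ENNReal.ofReal q * gibbsK F ℰp γ K (descendTo F ℰp J K ((Nat.le_succ J).trans hJK) ⁻¹' B) ≤
                  gibbsK F ℰp γ K (descendTo F ℰp J K ((Nat.le_succ J).trans hJK) ⁻¹' B ∩
                    {V | ∀ b : PBond (F.P (J + 1)) 0,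
                      dist1 ((σ (descendTo F ℰp J K ((Nat.le_succ J).trans hJK) V) b)⁻¹ *
                        descendTo F ℰp (J + 1) K hJK V b) < r}) := by
  refine Summit.QuantumFields.YangMills.Theorems.FluctuationComparisonRegPrIntLHaarTubeNoMargin.sectionTubeMassIntCan_of_up_low fun L => ?_
  obtain ⟨c₀, hc₀, hc₀1, hc⟩ := h L
  refine ⟨c₀, hc₀, hc₀1, fun c hcpos hcle => ?_⟩
  obtain ⟨pS, hpS⟩ := hc c hcpos hcle
  refine ⟨pS, fun b₀ p₀ hb₀ hpS' hp₀ => ?_⟩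
  obtain ⟨γ₁, hγ₁, hγ₁1, hγ₁F⟩ := hpS b₀ p₀ hb₀ hpS' hp₀
  refine ⟨γ₁, hγ₁, hγ₁1, fun F γ hFL hγ hγle J => ?_⟩
  obtain ⟨E, h5, h5low⟩ := hγ₁F F γ hFL hγ hγle
  have hL1 : 1 ≤ F.L := F.hL.2.le
  have hγ1 : γ ≤ 1 := hγle.trans hγ₁1
  have h2b₀ : 0 < 2 * b₀ := by linarith
  -- TUBE∘'s `⟨LOW(2θ)⟩` set is print's window at profile `2b₀`
  have hθeq : ∀ i : ℕ, 2 * θBal F.L γ b₀ p₀ i = θBal F.L γ (2 * b₀) p₀ i := fun i => (T3InteriorExcision.θBal_mul F.L γ 2 b₀ p₀ i).symm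
  have hup : HeightwiseUpperBound F γ := by
    obtain ⟨c0, hc0, h0⟩ := h5low 0
    refine heightwiseUpperBound_of_bounds5TwoSided hγ.le h5 ⟨θBal F.L γ (2 * b₀) p₀ 0, c0, ?_, hc0, fun K => h0 K (Nat.zero_le K)⟩
    exact T3MinimiserStabilityReduction.θBal_pos hL1 hγ hγ1 h2b₀ p₀ 0
  obtain ⟨C, hC, hUP⟩ := up_of_heightwiseUpperBound F hγ.le hup J
  obtain ⟨⟨cJ, hcJ, hlowJ⟩, ⟨O1, hO1⟩⟩ := And.intro (h5low (J + 1)) (h5 (J + 1))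
  have hθpos := T3MinimiserStabilityReduction.θBal_pos hL1 hγ hγ1 h2b₀ p₀ (J + 1)
  haveI := isProbabilityMeasure_fieldMeasure (G := Matrix.specialUnitaryGroup (Fin 2) ℂ) (F.P (J + 1)) 0
  refine ⟨C, cJ / Real.exp (O1 * ((F.P (J + 1)).sitesPerDir 0 : ℝ) ^ 3), hC, div_pos hcJ (Real.exp_pos _), fun K hJK => ⟨hUP K hJK _, ?_⟩⟩
  refine low_of_heightwiseLowerDensity F hγ.le hJK (measurableSet_plaqSmall _) ?_
  obtain ⟨hdm, hdi⟩ := heightDensity_props F hJK MeasurableSet.univ hγ.le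
  have hq := quotient_lower_ae (μ := fieldMeasure (F.P (J + 1)) 0 (Matrix.specialUnitaryGroup (Fin 2) ℂ)) hdi
    (heightDensity_nonneg F γ hJK Set.univ) (measurableSet_plaqSmall_window (F.P (J + 1)) 0 (θBal F.L γ (2 * b₀) p₀ (J + 1)))
    (measureReal_plaqSmall_pos (F.P (J + 1)) 0 hθpos) (Real.exp_pos (-E K)) hcJ (hO1 K hJK) (hlowJ K hJK)
  rw [integral_heightDensity_univ_eq_partitionFn F hγ.le hJK] at hq
  filter_upwards [hq] with V hV hVs
  exact hV (fun p => lt_of_lt_of_le (hVs p) (le_of_eq (hθeq (J + 1))))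


end Summit.QuantumFields.YangMills.Theorems.FluctuationComparisonRegPrIntLTubeFromBounds5Literal

end
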